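import Summits.AtomisticToContinuum.FouriersLaw.Theorems.OddSectorIrreversibilityConeScaleCorrectorStubCentredCorrector
import Literature.MathematicalPhysics.KineticTheory.OddSectorLocalityHypothesis

/-!
# `ConeScaleCorrector` (E1), line `one-crossing-echo-contraction`: stub (M) `stub_horizonCorrectorMemLp`

Registered stub of crux stmt-AtomisticToContinuum-14069 (fixed N): the finite-horizon Kubo correctors
`u_S(x) = ∫_{(0,S]} P_tJ_tot(x) dt` are in `L²(μ_T)`.

Route. For a continuous centred observable `f` with `|f| ≤ C e^{ϑH}` (`ϑ = 1/(4T)`, so `2ϑ < 1/T`), the scaled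
Harris bound `pinnedChain_harris_bound` gives `|P_{t⁺} f(z)| ≤ K C e^{ϑH(z)} e^{-ct}` for all real `t`
(`centred_abs_act_le`), hence `|u_S(z)| ≤ (KC/c) e^{ϑH(z)}` for EVERY real horizon `S`
(`∫_{(0,S]} e^{-ct} dt ≤ 1/c`); `u_S` is strongly measurable (joint measurability of `(t, z) ↦ P_{t⁺} f(z)`),
so `u_S ∈ L²(gibbsMeasure)` (`(u_S)² ≤ (KC/c)² e^{2ϑH} ∈ L¹`). Specialised to `f = J_tot` (`μ_T(J) = 0`) and
transferred to the unnormalised weight `μ_T = Z • gibbsMeasure` (`Z < ∞`). `N = 0`: `J ≡ 0`, `u_S = 0`.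
-/

noncomputable section

open MeasureTheory ProbabilityTheory Filter Topology Set
open scoped ENNReal NNReal BigOperators
open Literature.MathematicalPhysics.KineticTheory.HeatConduction
open Literature.MathematicalPhysics.KineticTheory.OddSectorLocality

namespace Summit.AtomisticToContinuum.FouriersLaw.Theorems.OddSectorIrreversibility

open Summit.AtomisticToContinuum.FouriersLaw.Theorems.LightConeBondHeat

/-! ### Finite-horizon correctors of a centred nice observable -/

/-- For a centred nice `f` (`μ_T(f) = 0`, `|f| ≤ C e^{ϑH}`, Harris constants `K, c`): the finite-horizon
corrector obeys `|∫_{(0,S]} P_{t⁺} f(z) dt| ≤ (K C / c) e^{ϑH(z)}` for EVERY real `S`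
(`|P_{t⁺} f(z)| ≤ K C e^{ϑH(z)} e^{-ct}` and `∫_{(0,S]} e^{-ct} dt ≤ ∫_{(0,∞)} e^{-ct} dt = 1/c`). [folklore] -/
theorem centred_abs_horizonCorrector_le {N : ℕ} {ω₂ lam β γ T ϑ K c C : ℝ} {f : PhaseSpace N → ℝ}
    (hK : 0 ≤ K)
    (hb : ∀ (z : PhaseSpace N) (t : ℝ≥0) (f : PhaseSpace N → ℝ), Continuous f →
      ∀ C : ℝ, 0 ≤ C → (∀ y, |f y| ≤ C * Real.exp (ϑ * (pinnedChain ω₂ lam β γ).hamiltonian N y)) →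
      |(∫ y, f y ∂((pinnedChain ω₂ lam β γ).transitionKernel N T T t z)) -
          ∫ y, f y ∂((pinnedChain ω₂ lam β γ).gibbsMeasure N T)| ≤
        K * C * Real.exp (ϑ * (pinnedChain ω₂ lam β γ).hamiltonian N z) * Real.exp (-c * t))
    (hc : 0 < c) (hf : Continuous f) (hC : 0 ≤ C)
    (hfb : ∀ y, |f y| ≤ C * Real.exp (ϑ * (pinnedChain ω₂ lam β γ).hamiltonian N y))
    (hf0 : ∫ y, f y ∂((pinnedChain ω₂ lam β γ).gibbsMeasure N T) = 0) (S : ℝ) (z : PhaseSpace N) :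
    |∫ t in Ioc (0 : ℝ) S, ∫ y, f y ∂((pinnedChain ω₂ lam β γ).transitionKernel N T T t.toNNReal z)| ≤
      K * C / c * Real.exp (ϑ * (pinnedChain ω₂ lam β γ).hamiltonian N z) := by
  set B := K * C * Real.exp (ϑ * (pinnedChain ω₂ lam β γ).hamiltonian N z) with hB
  have hB0 : 0 ≤ B := mul_nonneg (mul_nonneg hK hC) (Real.exp_pos _).le
  have hbound : ∀ᵐ t ∂(volume.restrict (Ioc (0 : ℝ) S)),
      ‖∫ y, f y ∂((pinnedChain ω₂ lam β γ).transitionKernel N T T t.toNNReal z)‖ ≤ B * Real.exp (-c * t) :=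
    Eventually.of_forall fun t => by
      rw [Real.norm_eq_abs]; exact centred_abs_act_le hK hb hc hf hC hfb hf0 z t
  have hI : Integrable (fun t : ℝ => B * Real.exp (-c * t)) (volume.restrict (Ioc (0 : ℝ) S)) :=
    ((exp_neg_integrableOn_Ioi 0 hc).mono_set Ioc_subset_Ioi_self).const_mul B
  have h := norm_integral_le_of_norm_le hI hbound
  have hexp : ∫ t in Ioc (0 : ℝ) S, Real.exp (-c * t) ≤ 1 / c := by
    calc ∫ t in Ioc (0 : ℝ) S, Real.exp (-c * t) ≤ ∫ t in Ioi (0 : ℝ), Real.exp (-c * t) :=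
          setIntegral_mono_set (exp_neg_integrableOn_Ioi 0 hc)
            (Eventually.of_forall fun t => (Real.exp_pos _).le) Ioc_subset_Ioi_self.eventuallyLE
      _ = 1 / c := by simpa only [neg_mul] using integral_exp_neg_mul_Ioi hc
  rw [Real.norm_eq_abs, integral_const_mul] at h
  calc _ ≤ B * ∫ t in Ioc (0 : ℝ) S, Real.exp (-c * t) := h
    _ ≤ B * (1 / c) := mul_le_mul_of_nonneg_left hexp hB0
    _ = _ := by rw [hB]; ring

/-- For a centred nice `f` with moreover `2ϑ < 1/T`: the finite-horizon corrector
`u_S = ∫_{(0,S]} P_{t⁺} f dt` is in `L²(gibbsMeasure)` for every real `S` — it is strongly measurable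
(joint measurability of `(t, z) ↦ P_{t⁺} f(z)`) and `(u_S)² ≤ (KC/c)² e^{2ϑH} ∈ L¹(gibbsMeasure)`.
[folklore] -/
theorem centred_memLp_horizonCorrector {N : ℕ} {ω₂ lam β γ T ϑ K c C : ℝ} {f : PhaseSpace N → ℝ}
    (hK : 0 ≤ K)
    (hb : ∀ (z : PhaseSpace N) (t : ℝ≥0) (f : PhaseSpace N → ℝ), Continuous f →
      ∀ C : ℝ, 0 ≤ C → (∀ y, |f y| ≤ C * Real.exp (ϑ * (pinnedChain ω₂ lam β γ).hamiltonian N y)) →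
      |(∫ y, f y ∂((pinnedChain ω₂ lam β γ).transitionKernel N T T t z)) -
          ∫ y, f y ∂((pinnedChain ω₂ lam β γ).gibbsMeasure N T)| ≤
        K * C * Real.exp (ϑ * (pinnedChain ω₂ lam β γ).hamiltonian N z) * Real.exp (-c * t))
    (hc : 0 < c) (hf : Continuous f) (hC : 0 ≤ C)
    (hfb : ∀ y, |f y| ≤ C * Real.exp (ϑ * (pinnedChain ω₂ lam β γ).hamiltonian N y))
    (hf0 : ∫ y, f y ∂((pinnedChain ω₂ lam β γ).gibbsMeasure N T) = 0)
    (hω : 0 < ω₂) (hl : 0 ≤ lam) (hβ : 0 ≤ β) (hγ : 0 ≤ γ) (hT : 0 < T) (h2ϑ : 2 * ϑ < 1 / T) (S : ℝ) :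
    MemLp (fun z => ∫ t in Ioc (0 : ℝ) S,
        ∫ y, f y ∂((pinnedChain ω₂ lam β γ).transitionKernel N T T t.toNNReal z))
      2 ((pinnedChain ω₂ lam β γ).gibbsMeasure N T) := by
  have hsm : StronglyMeasurable fun z : PhaseSpace N => ∫ t in Ioc (0 : ℝ) S,
      ∫ y, f y ∂((pinnedChain ω₂ lam β γ).transitionKernel N T T t.toNNReal z) :=
    StronglyMeasurable.integral_prod_left' (μ := volume.restrict (Ioc (0 : ℝ) S))
      (pinnedChain_stronglyMeasurable_act_uncurry hω hl hβ hγ T T hf.measurable)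
  rw [memLp_two_iff_integrable_sq hsm.aestronglyMeasurable]
  refine ((pinnedChain_integrable_exp_mul_hamiltonian_gibbsMeasure hω hl hβ γ N hT h2ϑ).const_mul
    ((K * C / c) ^ 2)).mono' (hsm.measurable.pow_const 2).aestronglyMeasurable
    (Eventually.of_forall fun z => ?_)
  rw [norm_pow, Real.norm_eq_abs]
  calc |∫ t in Ioc (0 : ℝ) S, ∫ y, f y ∂((pinnedChain ω₂ lam β γ).transitionKernel N T T t.toNNReal z)| ^ 2
      ≤ (K * C / c * Real.exp (ϑ * (pinnedChain ω₂ lam β γ).hamiltonian N z)) ^ 2 :=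
        pow_le_pow_left₀ (abs_nonneg _) (centred_abs_horizonCorrector_le hK hb hc hf hC hfb hf0 S z) 2
    _ = (K * C / c) ^ 2 * Real.exp (2 * ϑ * (pinnedChain ω₂ lam β γ).hamiltonian N z) := by
        rw [mul_pow, sq (Real.exp _), ← Real.exp_add]; congr 1; ring_nf

/-! ### The stub -/

/-- **(M) `stub_horizonCorrectorMemLp` — fixed-`N` regularity of the finite-horizon correctors.**
For every `N` and `S ≥ 0` (in fact every real `S`), `u_S = ∫_{(0,S]} P_tJ_tot dt ∈ L²(μ_T)`,
`μ_T = e^{-H_N/T}·Lebesgue` the unnormalised Gibbs weight. Proof: `μ_T = Z • gibbsMeasure` with `Z < ∞`;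
for `N ≥ 1` apply `centred_memLp_horizonCorrector` to `f = J_tot = ∑ jᵢ` (continuous, `|J| ≤ C e^{H/(4T)}`,
`μ_T(J) = 0`, Harris constants from `pinnedChain_harris_bound`); for `N = 0`, `J ≡ 0` and `u_S = 0`.
[folklore] -/
theorem stub_horizonCorrectorMemLp :
    ∀ ω₂ lam β γ : ℝ, 0 < ω₂ → 0 < lam → 0 < β → 0 < γ → ∀ T : ℝ, 0 < T → ∀ (N : ℕ) (S : ℝ), 0 ≤ S →
      MeasureTheory.MemLp
        (fun x : Literature.MathematicalPhysics.KineticTheory.HeatConduction.PhaseSpace N =>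
          ∫ t in Set.Ioc (0 : ℝ) S, Literature.MathematicalPhysics.KineticTheory.OddSectorLocality.currentForecast ω₂ lam β γ T N t x)
        2 (Literature.MathematicalPhysics.KineticTheory.OddSectorLocality.gibbsWeight ω₂ lam β γ T N) := by
  intro ω₂ lam β γ hω hl hβ hγ T hT N S _
  have hμ : gibbsWeight ω₂ lam β γ T N =
      (pinnedChain ω₂ lam β γ).partitionFunction N T • (pinnedChain ω₂ lam β γ).gibbsMeasure N T :=
    withDensity_exp_neg_hamiltonian_eq_smul_gibbsMeasure hω hl.le hβ.le γ N hT
  have hZtop := (pinnedChain ω₂ lam β γ).partitionFunction_ne_top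
    (pinnedChain_integrable_gibbsDensity hω hl.le hβ.le γ N hT)
  rw [hμ]
  refine MemLp.smul_measure ?_ hZtop
  rcases Nat.eq_zero_or_pos N with rfl | hN
  · have h0 : (fun x : PhaseSpace 0 => ∫ t in Ioc (0 : ℝ) S, currentForecast ω₂ lam β γ T 0 t x) =
        fun _ => 0 := by
      funext x
      simp only [currentForecast, Finset.univ_eq_empty, Finset.sum_empty, integral_zero]
    rw [h0]
    exact MemLp.zero'
  · obtain ⟨hϑ0, h2ϑ⟩ := quarter_inv_temp_admissible hT
    have hϑ1 : 1 / (4 * T) < 1 / T := by linarith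
    obtain ⟨K, c, hK, hc, hb⟩ := pinnedChain_harris_bound hω hl.le hβ hγ hN hT hϑ0 hϑ1
    have hJc := continuous_totalBondCurrent ω₂ lam β γ N
    have hJb := abs_totalBondCurrent_le_exp hω.le hl.le hβ.le γ N hϑ0
    have hJ0 := integral_totalBondCurrent_gibbsMeasure hω hl.le hβ.le γ N hT
    have hC : (0 : ℝ) ≤ N * (N * ((3 + β) / 2) * (2 * Real.exp (1 / (4 * T)) / (1 / (4 * T)) ^ 2)) := by
      have := hβ.le
      positivity
    exact centred_memLp_horizonCorrector hK.le hb hc hJc hC hJb hJ0 hω hl.le hβ.le hγ.le hT h2ϑ S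

end Summit.AtomisticToContinuum.FouriersLaw.Theorems.OddSectorIrreversibility
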